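/-
b2b-lace packet, TAIL-BOUND ANALYST gen 10 (unit `b2b-lace-tail-g10`).  (S2b)-IMPR-L3, the integrated node (S2)/(S3):
[NoBLE17] §3.3.5 Step 1 — the `Ĥ₁`-piece of the weighted diagram `ℋ^{n,l}_p(x)` bounded by the UNCHANGED `F3Bounds.boundH1 τ n l x r`
for `n = 0` and `n = 1`, i.e. the `hH1` binder of `abs_nobleH_le_boundHD75_of_pieces` (`NobleWeightedDiagramAssembly`) verbatim.
d-generic; no numeral, no dimension, no named fact; every existing module untouched.
-/
import Literature.Probability.FitznerVanDerHofstad2017.NobleH2Step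
import Literature.Probability.FitznerVanDerHofstad2017.NobleH1SlotAlgebra
import Literature.Probability.FitznerVanDerHofstad2017.SrwIntegralMassive
import Literature.Probability.FitznerVanDerHofstad2017.SrwIntegralJFarField
import HarnessLib

/-!
# Literature.Probability.FitznerVanDerHofstad2017.NobleH1Step — Step 1 of [NoBLE17] §3.3.5 integrated against the `(l,x)`-kernel

[NoBLE17] = Fitzner–van der Hofstad, *Generalized approach to the non-backtracking lace expansion*, PTRF 169 (2017) 1041–1119.

The Step-1 piece of the weighted diagram is `ℋ^{n,l}_{1,z}(x) = ∫ Ĥ₁(k) Ĝ_z(k)ⁿ D̂(k)^l D̂^{(x)}(k) dk/(2π)^d` ((3.58)–(3.59)) with the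
kernel atom `LapAtoms.H1 = (α_F (c_Φ + α_Φ D̂) Ĉ* + α_Φ) Ĉ* M̂*` ((3.52); `NobleLaplacianSplit`).  Expanding the prefactor and, for
`n = 1`, one factor `Ĝ = (c_Φ + α_Φ D̂) Ĉ* + [R̂_Φ − δ_{R,F} Ĝ] Ĉ*` ((3.64), `LapAtoms.G_eq_split`) writes `ℋ^{n,l}_1(x)` as a
combination of the SLOTS

  `X_{q,j}(x) := ∫ Ĉ*^q M̂* D̂^j D̂^{(x)} dP/(2π)^d`   (`q = 2, 3` ↔ the printed `m = q − 2 ∈ {0, 1}`; `q = 1` ↔ `m = −1`)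

plus, for `n = 1`, the (3.65)-remainder `∫ Ĥ₁ [R̂_Φ − δ_{R,F} Ĝ] Ĉ* D̂^l D̂^{(x)}`.  THIS MODULE proves

* `n = 0` (`abs_integral_H1_diagram_le_boundH1_zero`, `2·3+1 ≤ d`):
  `|ℋ^{0,l}_1(x)| ≤ c̄_Φ IM[0,l] + β_{α,Φ} IM[0,l+1] + (β_{α,Φ}/α̲_F) IM[−1,l] = F3Bounds.boundH1 τ 0 l x r`;
* `n = 1` (`abs_integral_H1_diagram_le_boundH1_one`, `2·4+1 ≤ d`):
  `|ℋ^{1,l}_1(x)| ≤ (five IM-slots) + (β_{R,Φ} + β_{ΔR,F} Γ₂′)/α̲_F² (c̄_Φ T[3,l] + β_{α,Φ} T[3,l+1] + β_{α,Φ} T[2,l]) = F3Bounds.boundH1 τ 1 l x r`,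

both stated LITERALLY in the shape of the `hH1` binder of `abs_nobleH_le_boundHD75_of_pieces` (integrand `Ĥ₁ · Ĝ ^ n · D̂ ^ l · D̂^{(x)}`).

INPUTS, all displayed as hypotheses or imported theorems (nothing is decided here about print-vs-code; see the READING NOTE):
* the key-quantity bounds `KeyBounds r` of the atoms on the cube off `{D̂ = 1}` (`hKB`, as produced by `keyBounds_and_split`), the strict
  window `c_F + α_F + R̂_F(0) < 1` (`hc0`) and `1 ≤ α̲_F` (`hα1`);
* the x-space slot bounds: for `m = −1` the THEOREMS `integral_Cstar_Mstar_le` / `neg_le_integral_Cstar_Mstar` of `SrwIntegralMassive`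
  ((3.63) as printed, two-sided); for `m = 0, 1` the two-sided bounds (S1a)/(S1b) as DISPLAYED hypotheses `hXup` / `hXlo`
  (`X_{m+2,j} ≤ 𝓙_{m+2,j}/α_F^{m+2} + (α_F−1) I_{m+3,j}/(d α_F^{m+3})` and `−(α_F−1) S_{m+3,j}/(2d² α_F^{m+3}) ≤ X_{m+2,j}`, `S` = `srwIShift2`),
  to be discharged by the massive-walk dictionary of `SrwIntegralMassive` (`integral_Cstar_pow_Mstar_eq`);
* the slot algebra `H1Slot.abs_alpha_mul_slot_le` / `abs_slot_le` / `abs_m1_slot_le` (`NobleH1SlotAlgebra`), which turns the two-sided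
  slot bounds into `|α_F^ε X| ≤ IM/α̲_F^{m+1−ε}` under the DISPLAYED table conditions `hIM` (`𝓙 ≤ IM`), `hSC` (`I_{m+3} ≤ d α̲_F IM`),
  `hLow` (`(ᾱ_F − 1) S_{m+3} ≤ 2d² IM`), and for `m = −1` `hIM1`, `hLow1`;
* for the `n = 1` remainder: the pointwise `KeyBounds` algebra of `NobleLaplacianBounds` (`abs_cΦ_add_le`, `αF_mul_Cstar_le`, `Cstar_le`,
  `abs_Mstar_le'`, `abs_RΦ_sub_δG_mul_Cstar_le`) and the `T`-slot shell of `NobleH2Step` (`srwTS`, `integral_div_le_of_le_three_monomials`)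
  under the displayed table condition `hT` (`TS_{m,l} ≤ τ.T m l`), exactly as in Step 2.

READING NOTE (Lean-vs-print; recorded in the packet's DIVERGENCE.md as D80; nothing here decides it).  The printed one-sided slot bounds
(3.61)/(3.62) `X_{m,l} ≤ 𝓙_{m,l}/α_F^{m+1}` are used in print for `|X_{m,l}|`; the form displayed here is two-sided and carries the
`(α_F − 1)`-corrections, and the table conditions `hSC`/`hLow` are what make the printed coefficients of `BoundH[1]` (= `F3Bounds.boundH1`,
transcribed verbatim from `General.nb` and UNCHANGED) dominate.  Whether those conditions hold for a given table is a numerical question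
answered elsewhere (certificate side), not here.

Heartbeat census (packet filing rule, REFEREE ORDERS v73 (2)): every declaration of this file elaborates under
`set_option maxHeartbeats 50000` (pre-filing farm elaboration of a capped twin, rc 0), i.e. each is below 50 000 < 100 000;
no `maxHeartbeats` option is set anywhere in this file.
-/

noncomputable section

open MeasureTheory Real
open Literature.Barriers.CriticalPhenomena
open Literature.Barriers.CriticalPhenomena.Slade2006Prop53 (P)
open Literature.Probability.LatticeModels

namespace Literature.Probability.FitznerVanDerHofstad2017

variable {d : ℕ}

/-! ## Pointwise: the (3.65)-remainder factor of `Ĥ₁ Ĝ` under `KeyBounds` -/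

namespace LapAtoms.KeyBounds

variable {a : LapAtoms} {r : F3Bounds.Args}

/-- **Step 1, the remainder factor, pointwise** ((3.64)–(3.65) with (3.40)–(3.43), (3.47)–(3.48)): at a point with `KeyBounds r`,
`|Ĥ₁ · [R̂_Φ − δ_{R,F} Ĝ] Ĉ*| ≤ ((c̄_Φ + β_{α,Φ}|D̂|) Ĉ + β_{α,Φ}) (Ĉ/α̲_F) (|D̂| + 2 D̂^{sin} Ĉ/α̲_F) ((β_{R,Φ} + β_{ΔR,F} Γ₂′)/α̲_F · Ĉ)`
(`Ĉ = 1/[1 − D̂]`).  [cite: FitznerVanDerHofstad2016NoBLE, §3.3.5 (3.64)–(3.66) p. 1076] -/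
theorem abs_H1_mul_rem_le (h : a.KeyBounds r) :
    |a.H1 * ((a.RΦ - a.δRF * a.G) * a.Cstar)| ≤
      ((r.cp + r.ap * |a.D|) * (1 / (1 - a.D)) + r.ap) * (1 / (1 - a.D) / r.afmin) *
        (|a.D| + 2 * a.Dsin * (1 / (1 - a.D) / r.afmin)) *
        ((r.bRp + r.bRfDelta * r.Gamma2dash) / r.afmin * (1 / (1 - a.D))) := by
  set C := 1 / (1 - a.D) with hCdef
  have hC : 0 < C := h.C_pos
  have hcp : 0 ≤ r.cp := h.cp_nn
  have hap : 0 ≤ r.ap := h.ap_nn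
  have haf : 0 < r.afmin := h.afmin_pos
  have hDs : 0 ≤ a.Dsin := h.Dsin_nn
  have hCs : 0 < a.Cstar := h.Cstar_pos
  have h1 : |a.αF * (a.cΦ + a.αΦ * a.D) * a.Cstar + a.αΦ| ≤ (r.cp + r.ap * |a.D|) * C + r.ap := by
    refine (abs_add_le _ _).trans (add_le_add ?_ h.αΦ_abs)
    rw [abs_mul, abs_mul, abs_of_pos h.αF_pos, abs_of_pos hCs]
    calc a.αF * |a.cΦ + a.αΦ * a.D| * a.Cstar = |a.cΦ + a.αΦ * a.D| * (a.αF * a.Cstar) := by ring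
      _ ≤ (r.cp + r.ap * |a.D|) * C :=
        mul_le_mul h.abs_cΦ_add_le h.αF_mul_Cstar_le (mul_pos h.αF_pos hCs).le (by positivity)
  have hB1 : 0 ≤ (r.cp + r.ap * |a.D|) * C + r.ap := by positivity
  have hsplit : |a.H1 * ((a.RΦ - a.δRF * a.G) * a.Cstar)| =
      |a.αF * (a.cΦ + a.αΦ * a.D) * a.Cstar + a.αΦ| * a.Cstar * |a.Mstar| * |(a.RΦ - a.δRF * a.G) * a.Cstar| := by
    simp only [LapAtoms.H1, abs_mul, abs_of_pos hCs]
  rw [hsplit]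
  exact mul_le_mul (mul_le_mul (mul_le_mul h1 h.Cstar_le hCs.le hB1) h.abs_Mstar_le' (abs_nonneg _)
    (by positivity)) h.abs_RΦ_sub_δG_mul_Cstar_le (abs_nonneg _) (by positivity)

end LapAtoms.KeyBounds

/-! ## Linearity shells on the torus measure `P d` -/

/-- `∫ (c₁f₁ + c₂f₂ + c₃f₃)/(2π)^d = c₁ ∫f₁/(2π)^d + c₂ ∫f₂/(2π)^d + c₃ ∫f₃/(2π)^d` for integrable `fᵢ`. [folklore] -/
theorem integral_div_three_terms {f₁ f₂ f₃ : (Fin d → ℝ) → ℝ} (c₁ c₂ c₃ : ℝ)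
    (h₁ : Integrable f₁ (P d)) (h₂ : Integrable f₂ (P d)) (h₃ : Integrable f₃ (P d)) :
    (∫ k, c₁ * f₁ k + c₂ * f₂ k + c₃ * f₃ k ∂P d) / (2 * π) ^ d =
      c₁ * ((∫ k, f₁ k ∂P d) / (2 * π) ^ d) + c₂ * ((∫ k, f₂ k ∂P d) / (2 * π) ^ d) +
        c₃ * ((∫ k, f₃ k ∂P d) / (2 * π) ^ d) := by
  have h12 : Integrable (fun k => c₁ * f₁ k + c₂ * f₂ k) (P d) := (h₁.const_mul c₁).add (h₂.const_mul c₂)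
  rw [integral_add h12 (h₃.const_mul c₃), integral_add (h₁.const_mul c₁) (h₂.const_mul c₂),
    integral_const_mul, integral_const_mul, integral_const_mul]
  ring

/-- Five-term version of `integral_div_three_terms`. [folklore] -/
theorem integral_div_five_terms {f₁ f₂ f₃ f₄ f₅ : (Fin d → ℝ) → ℝ} (c₁ c₂ c₃ c₄ c₅ : ℝ)
    (h₁ : Integrable f₁ (P d)) (h₂ : Integrable f₂ (P d)) (h₃ : Integrable f₃ (P d))
    (h₄ : Integrable f₄ (P d)) (h₅ : Integrable f₅ (P d)) :
    (∫ k, c₁ * f₁ k + c₂ * f₂ k + c₃ * f₃ k + c₄ * f₄ k + c₅ * f₅ k ∂P d) / (2 * π) ^ d =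
      c₁ * ((∫ k, f₁ k ∂P d) / (2 * π) ^ d) + c₂ * ((∫ k, f₂ k ∂P d) / (2 * π) ^ d) +
        c₃ * ((∫ k, f₃ k ∂P d) / (2 * π) ^ d) + c₄ * ((∫ k, f₄ k ∂P d) / (2 * π) ^ d) +
        c₅ * ((∫ k, f₅ k ∂P d) / (2 * π) ^ d) := by
  have h12 : Integrable (fun k => c₁ * f₁ k + c₂ * f₂ k) (P d) := (h₁.const_mul c₁).add (h₂.const_mul c₂)
  have h123 : Integrable (fun k => c₁ * f₁ k + c₂ * f₂ k + c₃ * f₃ k) (P d) := h12.add (h₃.const_mul c₃)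
  have h1234 : Integrable (fun k => c₁ * f₁ k + c₂ * f₂ k + c₃ * f₃ k + c₄ * f₄ k) (P d) :=
    h123.add (h₄.const_mul c₄)
  rw [integral_add h1234 (h₅.const_mul c₅), integral_add h123 (h₄.const_mul c₄),
    integral_add h12 (h₃.const_mul c₃), integral_add (h₁.const_mul c₁) (h₂.const_mul c₂),
    integral_const_mul, integral_const_mul, integral_const_mul, integral_const_mul, integral_const_mul]
  ring

/-! ## The Step-1 slots at the simplified-form atoms `lapAtomsAt` -/

section StepOne

variable {cΦ αΦ cF αF : ℝ} {RΦ RF : Site d → ℝ} {r : F3Bounds.Args}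

/-- The constants recorded by `KeyBounds r` at any single point of the cube off `{D̂ = 1}` (the point `π e₀` has `1 − D̂ = 2/d > 0`):
`α̲_F ≤ α_F ≤ ᾱ_F`, `0 ≤ c_Φ ≤ c̄_Φ`, `|α_Φ| ≤ β_{α,Φ}`, `0 ≤ β_{R,Φ} + β_{ΔR,F} Γ₂′`. [folklore] -/
theorem keyBounds_consts (hd : 1 ≤ d)
    (hKB : ∀ k ∈ cube d, Dhat d k < 1 → (lapAtomsAt d cΦ αΦ cF αF RΦ RF k).KeyBounds r) :
    r.afmin ≤ αF ∧ αF ≤ r.afmax ∧ 0 ≤ cΦ ∧ cΦ ≤ r.cp ∧ |αΦ| ≤ r.ap ∧ 0 ≤ r.bRp + r.bRfDelta * r.Gamma2dash := by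
  haveI : NeZero d := ⟨by omega⟩
  have hk : (Pi.single (⟨0, by omega⟩ : Fin d) π : Fin d → ℝ) ∈ cube d :=
    single_mem_cube _ (abs_of_pos Real.pi_pos).le
  have hD : Dhat d (Pi.single (⟨0, by omega⟩ : Fin d) π) < 1 := by
    have h1 := one_sub_Dhat_single (d := d) (⟨0, by omega⟩ : Fin d) π
    rw [Real.cos_pi] at h1
    have hd0 : (0 : ℝ) < d := by exact_mod_cast (show 0 < d by omega)
    have h2 : (0 : ℝ) < (1 - (-1)) / d := div_pos (by norm_num) hd0
    linarith
  have h := hKB _ hk hD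
  exact ⟨h.αF_ge, h.αF_le, h.cΦ_nn, h.cΦ_le, h.αΦ_abs,
    add_nonneg h.bRp_nn (mul_nonneg h.bRfDelta_nn h.Gamma2dash_nn)⟩

/-- On the strict window `c_F + α_F + R̂_F(0) < 1` with `α_F ≥ 0` every slot integrand `Ĉ*^q M̂* D̂^j D̂^{(x)}` is continuous on the
torus, hence integrable (`Ĉ* = a Ĉ_μ` with `0 ≤ μ < 1`, `M̂* = D̂ − 2 D̂^{sin} Ĉ*`). [folklore] -/
theorem integrable_Cstar_pow_Mstar_weight (hc0 : cF + αF + cosFT RF 0 < 1) (hα : 0 ≤ αF) (q j : ℕ)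
    (x : Fin d → ℤ) :
    Integrable (fun k => (lapAtomsAt d cΦ αΦ cF αF RΦ RF k).Cstar ^ q *
      (lapAtomsAt d cΦ αΦ cF αF RΦ RF k).Mstar * (Dhat d k ^ j * DhatSym d x k)) (P d) := by
  obtain ⟨-, hμ0, hμ1⟩ := stepOne_params (d := d) (RF := RF) hc0 hα
  have hne : 1 - (cF + αF + cosFT RF 0) + αF ≠ 0 := by linarith
  have hCc : Continuous fun k => (lapAtomsAt d cΦ αΦ cF αF RΦ RF k).Cstar := by
    simp_rw [lapAtomsAt_Cstar_eq (cΦ := cΦ) (αΦ := αΦ) (RΦ := RΦ) hne]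
    exact continuous_const.mul (continuous_Chat_of_lt_one hμ0 hμ1)
  have hMc : Continuous fun k => (lapAtomsAt d cΦ αΦ cF αF RΦ RF k).Mstar := by
    simp_rw [lapAtomsAt_Mstar_eq]
    exact (continuous_Dhat d).sub ((continuous_const.mul (continuous_Dsin d)).mul hCc)
  have hcont : Continuous fun k => (lapAtomsAt d cΦ αΦ cF αF RΦ RF k).Cstar ^ q *
      (lapAtomsAt d cΦ αΦ cF αF RΦ RF k).Mstar * (Dhat d k ^ j * DhatSym d x k) :=
    ((hCc.pow q).mul hMc).mul (((continuous_Dhat d).pow j).mul (continuous_DhatSym d x))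
  rw [← Slade2006Prop53.volume_restrict_cube d]
  exact hcont.continuousOn.integrableOn_compact (isCompact_univ_pi fun _ => isCompact_Icc)

/-- **[NoBLE17] §3.3.5 Step 1, `n = 0`, Tables form** ((3.58)–(3.63), (3.71); `General.nb` `BoundH[1]` at `n = 0`):
for `2·3+1 ≤ d`, atoms with `KeyBounds r` on the cube off `{D̂ = 1}`, the strict window, `1 ≤ α̲_F`, the two-sided x-space bounds of the
`m = 0` slot (`hXup`, `hXlo`) and a table `τ` with `𝓙_{2,j} ≤ IM[0,j]`, `I_{3,j} ≤ d α̲_F IM[0,j]`, `(ᾱ_F − 1) S_{3,j} ≤ 2d² IM[0,j]`,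
`I_{1,j+1} + S_{2,j}/(2d² α̲_F) ≤ IM[−1,j]`, `I_{2,j} ≤ d α̲_F IM[−1,j]`:
`|∫ Ĥ₁ Ĝ⁰ D̂^l D̂^{(x)} dP/(2π)^d| ≤ c̄_Φ IM[0,l] + β_{α,Φ} IM[0,l+1] + (β_{α,Φ}/α̲_F) IM[−1,l] = F3Bounds.boundH1 τ 0 l x r`.
[cite: FitznerVanDerHofstad2016NoBLE, §3.3.5 (3.58)–(3.63), (3.71) pp. 1074–1077; FitznerVanDerHofstad2017, notebook General.nb In[2] BoundH[1]] -/
theorem abs_integral_H1_diagram_le_boundH1_zero (hd : 2 * 3 + 1 ≤ d)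
    (hKB : ∀ k ∈ cube d, Dhat d k < 1 → (lapAtomsAt d cΦ αΦ cF αF RΦ RF k).KeyBounds r)
    (hc0 : cF + αF + cosFT RF 0 < 1) (hα1 : 1 ≤ r.afmin) (τ : F3Bounds.Tables (Fin d → ℤ))
    (hXup : ∀ j y, (∫ k, (lapAtomsAt d cΦ αΦ cF αF RΦ RF k).Cstar ^ 2 * (lapAtomsAt d cΦ αΦ cF αF RΦ RF k).Mstar *
        (Dhat d k ^ j * DhatSym d y k) ∂P d) / (2 * π) ^ d
      ≤ srwJ d 2 j y / αF ^ 2 + (αF - 1) * srwI d 3 j y / (d * αF ^ 3))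
    (hXlo : ∀ j y, -((αF - 1) * srwIShift2 d 3 j y / (2 * (d : ℝ) ^ 2 * αF ^ 3))
      ≤ (∫ k, (lapAtomsAt d cΦ αΦ cF αF RΦ RF k).Cstar ^ 2 * (lapAtomsAt d cΦ αΦ cF αF RΦ RF k).Mstar *
        (Dhat d k ^ j * DhatSym d y k) ∂P d) / (2 * π) ^ d)
    (hIM : ∀ j y, srwJ d 2 j y ≤ τ.IM 0 j y)
    (hSC : ∀ j y, srwI d 3 j y ≤ d * r.afmin * τ.IM 0 j y)
    (hLow : ∀ j y, (r.afmax - 1) * srwIShift2 d 3 j y ≤ 2 * (d : ℝ) ^ 2 * τ.IM 0 j y)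
    (hIM1 : ∀ j y, srwI d 1 (j + 1) y + srwIShift2 d 2 j y / (2 * (d : ℝ) ^ 2 * r.afmin) ≤ τ.IM (-1) j y)
    (hLow1 : ∀ j y, srwI d 2 j y ≤ d * r.afmin * τ.IM (-1) j y) (l : ℕ) (x : Fin d → ℤ) :
    |(∫ k, (lapAtomsAt d cΦ αΦ cF αF RΦ RF k).H1 * (lapAtomsAt d cΦ αΦ cF αF RΦ RF k).G ^ 0 *
        Dhat d k ^ l * DhatSym d x k ∂P d) / (2 * π) ^ d| ≤ F3Bounds.boundH1 τ 0 l x r := by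
  obtain ⟨hαF, hαFup, hcΦ0, hcΦ, hαΦ, -⟩ := keyBounds_consts (by omega) hKB
  have hα : 1 ≤ αF := hα1.trans hαF
  have haf : 0 < r.afmin := by linarith
  have hd0 : (0 : ℝ) < d := by exact_mod_cast (show 0 < d by omega)
  have hcp : 0 ≤ r.cp := hcΦ0.trans hcΦ
  have hap : 0 ≤ r.ap := (abs_nonneg _).trans hαΦ
  have hI : ∀ q j, Integrable (fun k => (lapAtomsAt d cΦ αΦ cF αF RΦ RF k).Cstar ^ q *
      (lapAtomsAt d cΦ αΦ cF αF RΦ RF k).Mstar * (Dhat d k ^ j * DhatSym d x k)) (P d) :=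
    fun q j => integrable_Cstar_pow_Mstar_weight hc0 (by linarith) q j x
  -- the three slot integrands
  set f1 : (Fin d → ℝ) → ℝ := fun k => (lapAtomsAt d cΦ αΦ cF αF RΦ RF k).Cstar ^ 2 *
    (lapAtomsAt d cΦ αΦ cF αF RΦ RF k).Mstar * (Dhat d k ^ l * DhatSym d x k) with hf1
  set f2 : (Fin d → ℝ) → ℝ := fun k => (lapAtomsAt d cΦ αΦ cF αF RΦ RF k).Cstar ^ 2 *
    (lapAtomsAt d cΦ αΦ cF αF RΦ RF k).Mstar * (Dhat d k ^ (l + 1) * DhatSym d x k) with hf2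
  set f3 : (Fin d → ℝ) → ℝ := fun k => (lapAtomsAt d cΦ αΦ cF αF RΦ RF k).Cstar *
    (lapAtomsAt d cΦ αΦ cF αF RΦ RF k).Mstar * (Dhat d k ^ l * DhatSym d x k) with hf3
  have hf1i : Integrable f1 (P d) := hI 2 l
  have hf2i : Integrable f2 (P d) := hI 2 (l + 1)
  have hf3i : Integrable f3 (P d) := by
    have h := hI 1 l
    simp only [pow_one] at h
    exact h
  -- the (3.52)/(3.59) expansion at `n = 0`, pointwise and integrated
  have hpt : ∀ k, (lapAtomsAt d cΦ αΦ cF αF RΦ RF k).H1 * (lapAtomsAt d cΦ αΦ cF αF RΦ RF k).G ^ 0 *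
      Dhat d k ^ l * DhatSym d x k = cΦ * αF * f1 k + αΦ * αF * f2 k + αΦ * f3 k := by
    intro k
    simp only [hf1, hf2, hf3, LapAtoms.H1, lapAtomsAt_αF, lapAtomsAt_cΦ, lapAtomsAt_αΦ, lapAtomsAt_D]
    ring
  have hsplit : (∫ k, (lapAtomsAt d cΦ αΦ cF αF RΦ RF k).H1 * (lapAtomsAt d cΦ αΦ cF αF RΦ RF k).G ^ 0 *
        Dhat d k ^ l * DhatSym d x k ∂P d) / (2 * π) ^ d
      = cΦ * αF * ((∫ k, f1 k ∂P d) / (2 * π) ^ d) + αΦ * αF * ((∫ k, f2 k ∂P d) / (2 * π) ^ d)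
        + αΦ * ((∫ k, f3 k ∂P d) / (2 * π) ^ d) := by
    rw [integral_congr_ae (ae_of_all _ hpt)]
    exact integral_div_three_terms _ _ _ hf1i hf2i hf3i
  -- the three slot bounds
  have hIM0 : ∀ j, 0 ≤ τ.IM 0 j x := fun j =>
    nonneg_of_mul_nonneg_right ((srwI_nonneg 3 (by omega) j x).trans (hSC j x)) (mul_pos hd0 haf)
  have b1 : |αF * ((∫ k, f1 k ∂P d) / (2 * π) ^ d)| ≤ τ.IM 0 l x := by
    have h := H1Slot.abs_alpha_mul_slot_le (dR := (d : ℝ)) 0 hd0 hα1 hαF hαFup (hIM0 l) (hIM l x)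
      (srwIShift2_nonneg (p := 3) (by omega) l x) (hSC l x) (hLow l x) (hXup l x) (hXlo l x)
    simp only [pow_zero, div_one] at h
    exact h
  have b2 : |αF * ((∫ k, f2 k ∂P d) / (2 * π) ^ d)| ≤ τ.IM 0 (l + 1) x := by
    have h := H1Slot.abs_alpha_mul_slot_le (dR := (d : ℝ)) 0 hd0 hα1 hαF hαFup (hIM0 (l + 1)) (hIM (l + 1) x)
      (srwIShift2_nonneg (p := 3) (by omega) (l + 1) x) (hSC (l + 1) x) (hLow (l + 1) x) (hXup (l + 1) x) (hXlo (l + 1) x)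
    simp only [pow_zero, div_one] at h
    exact h
  have b3 : |(∫ k, f3 k ∂P d) / (2 * π) ^ d| ≤ τ.IM (-1) l x / r.afmin :=
    H1Slot.abs_m1_slot_le (dR := (d : ℝ)) hd0 hα1 hαF (srwI_nonneg 1 (by omega) (l + 1) x)
      (srwIShift2_nonneg (p := 2) (by omega) l x) (hIM1 l x) (hLow1 l x)
      (integral_Cstar_Mstar_le (cΦ := cΦ) (αΦ := αΦ) (RΦ := RΦ) (by omega) hc0 hα l x)
      (neg_le_integral_Cstar_Mstar (cΦ := cΦ) (αΦ := αΦ) (RΦ := RΦ) (by omega) hc0 hα l x)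
  -- assemble
  have hbd0 : F3Bounds.boundH1 τ 0 l x r
      = r.cp * τ.IM 0 l x + r.ap * τ.IM 0 (l + 1) x + r.ap / r.afmin * τ.IM (-1) l x := rfl
  rw [hsplit]
  have e : cΦ * αF * ((∫ k, f1 k ∂P d) / (2 * π) ^ d) + αΦ * αF * ((∫ k, f2 k ∂P d) / (2 * π) ^ d)
        + αΦ * ((∫ k, f3 k ∂P d) / (2 * π) ^ d)
      = cΦ * (αF * ((∫ k, f1 k ∂P d) / (2 * π) ^ d)) + αΦ * (αF * ((∫ k, f2 k ∂P d) / (2 * π) ^ d))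
        + αΦ * ((∫ k, f3 k ∂P d) / (2 * π) ^ d) := by ring
  rw [e]
  have i1 : |cΦ * (αF * ((∫ k, f1 k ∂P d) / (2 * π) ^ d))| ≤ r.cp * τ.IM 0 l x := by
    rw [abs_mul, abs_of_nonneg hcΦ0]; exact mul_le_mul hcΦ b1 (abs_nonneg _) hcp
  have i2 : |αΦ * (αF * ((∫ k, f2 k ∂P d) / (2 * π) ^ d))| ≤ r.ap * τ.IM 0 (l + 1) x := by
    rw [abs_mul]; exact mul_le_mul hαΦ b2 (abs_nonneg _) hap
  have i3 : |αΦ * ((∫ k, f3 k ∂P d) / (2 * π) ^ d)| ≤ r.ap * (τ.IM (-1) l x / r.afmin) := by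
    rw [abs_mul]; exact mul_le_mul hαΦ b3 (abs_nonneg _) hap
  calc _ ≤ |cΦ * (αF * ((∫ k, f1 k ∂P d) / (2 * π) ^ d))| + |αΦ * (αF * ((∫ k, f2 k ∂P d) / (2 * π) ^ d))|
        + |αΦ * ((∫ k, f3 k ∂P d) / (2 * π) ^ d)| := abs_add_three _ _ _
    _ ≤ r.cp * τ.IM 0 l x + r.ap * τ.IM 0 (l + 1) x + r.ap * (τ.IM (-1) l x / r.afmin) := add_le_add_three i1 i2 i3
    _ = F3Bounds.boundH1 τ 0 l x r := by rw [hbd0]; ring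

/-- **[NoBLE17] §3.3.5 Step 1, `n = 1`, Tables form** ((3.58)–(3.66), (3.71); `General.nb` `BoundH[1]` at `n = 1`):
for `2·4+1 ≤ d`, atoms with `KeyBounds r` on the cube off `{D̂ = 1}`, the strict window, `1 ≤ α̲_F`, the two-sided x-space bounds of the
`m = 0, 1` slots (`hXup`, `hXlo`), a table `τ` with `𝓙_{m+2,j} ≤ IM[m,j]`, `I_{m+3,j} ≤ d α̲_F IM[m,j]`, `(ᾱ_F − 1) S_{m+3,j} ≤ 2d² IM[m,j]`
(`m ≤ 1`) and `TS_{m,j} ≤ T[m,j]` (`srwTS` of `NobleH2Step`):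
`|∫ Ĥ₁ Ĝ¹ D̂^l D̂^{(x)} dP/(2π)^d| ≤ c̄_Φ²/α̲_F IM[1,l] + c̄_Φβ_{α,Φ}/α̲_F IM[0,l] + 2(β_{α,Φ}c̄_Φ/α̲_F) IM[1,l+1] + β_{α,Φ}²/α̲_F IM[0,l+1]
+ β_{α,Φ}²/α̲_F IM[1,l+2] + (β_{R,Φ} + β_{ΔR,F}Γ₂′)/α̲_F² (c̄_Φ T[3,l] + β_{α,Φ} T[3,l+1] + β_{α,Φ} T[2,l]) = F3Bounds.boundH1 τ 1 l x r`.
(If the signed integrand is not integrable the left side is `0` by convention and the bound holds trivially; the integrable case is the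
content.)
[cite: FitznerVanDerHofstad2016NoBLE, §3.3.5 (3.58)–(3.66), (3.71) pp. 1074–1077; FitznerVanDerHofstad2017, notebook General.nb In[2] BoundH[1]] -/
theorem abs_integral_H1_diagram_le_boundH1_one (hd : 2 * 4 + 1 ≤ d)
    (hKB : ∀ k ∈ cube d, Dhat d k < 1 → (lapAtomsAt d cΦ αΦ cF αF RΦ RF k).KeyBounds r)
    (hc0 : cF + αF + cosFT RF 0 < 1) (hα1 : 1 ≤ r.afmin) (τ : F3Bounds.Tables (Fin d → ℤ))
    (hXup : ∀ (m j : ℕ) (y : Fin d → ℤ), m ≤ 1 →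
      (∫ k, (lapAtomsAt d cΦ αΦ cF αF RΦ RF k).Cstar ^ (m + 2) * (lapAtomsAt d cΦ αΦ cF αF RΦ RF k).Mstar *
          (Dhat d k ^ j * DhatSym d y k) ∂P d) / (2 * π) ^ d
        ≤ srwJ d (m + 2) j y / αF ^ (m + 2) + (αF - 1) * srwI d (m + 3) j y / (d * αF ^ (m + 3)))
    (hXlo : ∀ (m j : ℕ) (y : Fin d → ℤ), m ≤ 1 → -((αF - 1) * srwIShift2 d (m + 3) j y / (2 * (d : ℝ) ^ 2 * αF ^ (m + 3)))
        ≤ (∫ k, (lapAtomsAt d cΦ αΦ cF αF RΦ RF k).Cstar ^ (m + 2) * (lapAtomsAt d cΦ αΦ cF αF RΦ RF k).Mstar *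
          (Dhat d k ^ j * DhatSym d y k) ∂P d) / (2 * π) ^ d)
    (hIM : ∀ (m j : ℕ) (y : Fin d → ℤ), m ≤ 1 → srwJ d (m + 2) j y ≤ τ.IM m j y)
    (hSC : ∀ (m j : ℕ) (y : Fin d → ℤ), m ≤ 1 → srwI d (m + 3) j y ≤ d * r.afmin * τ.IM m j y)
    (hLow : ∀ (m j : ℕ) (y : Fin d → ℤ), m ≤ 1 → (r.afmax - 1) * srwIShift2 d (m + 3) j y ≤ 2 * (d : ℝ) ^ 2 * τ.IM m j y)
    (hT : ∀ (m j : ℕ) (y : Fin d → ℤ), srwTS d r.afmin m j y ≤ τ.T m j y) (l : ℕ) (x : Fin d → ℤ) :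
    |(∫ k, (lapAtomsAt d cΦ αΦ cF αF RΦ RF k).H1 * (lapAtomsAt d cΦ αΦ cF αF RΦ RF k).G ^ 1 *
        Dhat d k ^ l * DhatSym d x k ∂P d) / (2 * π) ^ d| ≤ F3Bounds.boundH1 τ 1 l x r := by
  obtain ⟨hαF, hαFup, hcΦ0, hcΦ, hαΦ, hβ⟩ := keyBounds_consts (by omega) hKB
  have hα : 1 ≤ αF := hα1.trans hαF
  have haf : 0 < r.afmin := by linarith
  have hd0 : (0 : ℝ) < d := by exact_mod_cast (show 0 < d by omega)
  have hcp : 0 ≤ r.cp := hcΦ0.trans hcΦ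
  have hap : 0 ≤ r.ap := (abs_nonneg _).trans hαΦ
  have hI : ∀ q j, Integrable (fun k => (lapAtomsAt d cΦ αΦ cF αF RΦ RF k).Cstar ^ q *
      (lapAtomsAt d cΦ αΦ cF αF RΦ RF k).Mstar * (Dhat d k ^ j * DhatSym d x k)) (P d) :=
    fun q j => integrable_Cstar_pow_Mstar_weight hc0 (by linarith) q j x
  -- the five slot integrands and the (3.65)-remainder
  set f1 : (Fin d → ℝ) → ℝ := fun k => (lapAtomsAt d cΦ αΦ cF αF RΦ RF k).Cstar ^ 3 *
    (lapAtomsAt d cΦ αΦ cF αF RΦ RF k).Mstar * (Dhat d k ^ l * DhatSym d x k) with hf1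
  set f2 : (Fin d → ℝ) → ℝ := fun k => (lapAtomsAt d cΦ αΦ cF αF RΦ RF k).Cstar ^ 3 *
    (lapAtomsAt d cΦ αΦ cF αF RΦ RF k).Mstar * (Dhat d k ^ (l + 1) * DhatSym d x k) with hf2
  set f3 : (Fin d → ℝ) → ℝ := fun k => (lapAtomsAt d cΦ αΦ cF αF RΦ RF k).Cstar ^ 3 *
    (lapAtomsAt d cΦ αΦ cF αF RΦ RF k).Mstar * (Dhat d k ^ (l + 2) * DhatSym d x k) with hf3
  set f4 : (Fin d → ℝ) → ℝ := fun k => (lapAtomsAt d cΦ αΦ cF αF RΦ RF k).Cstar ^ 2 *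
    (lapAtomsAt d cΦ αΦ cF αF RΦ RF k).Mstar * (Dhat d k ^ l * DhatSym d x k) with hf4
  set f5 : (Fin d → ℝ) → ℝ := fun k => (lapAtomsAt d cΦ αΦ cF αF RΦ RF k).Cstar ^ 2 *
    (lapAtomsAt d cΦ αΦ cF αF RΦ RF k).Mstar * (Dhat d k ^ (l + 1) * DhatSym d x k) with hf5
  set R : (Fin d → ℝ) → ℝ := fun k => (lapAtomsAt d cΦ αΦ cF αF RΦ RF k).H1 *
    (((lapAtomsAt d cΦ αΦ cF αF RΦ RF k).RΦ - (lapAtomsAt d cΦ αΦ cF αF RΦ RF k).δRF *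
        (lapAtomsAt d cΦ αΦ cF αF RΦ RF k).G) * (lapAtomsAt d cΦ αΦ cF αF RΦ RF k).Cstar) *
      (Dhat d k ^ l * DhatSym d x k) with hR
  have hf1i : Integrable f1 (P d) := hI 3 l
  have hf2i : Integrable f2 (P d) := hI 3 (l + 1)
  have hf3i : Integrable f3 (P d) := hI 3 (l + 2)
  have hf4i : Integrable f4 (P d) := hI 2 l
  have hf5i : Integrable f5 (P d) := hI 2 (l + 1)
  have hmainI : Integrable (fun k => cΦ ^ 2 * αF * f1 k + 2 * (cΦ * αΦ) * αF * f2 k + αΦ ^ 2 * αF * f3 k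
      + αΦ * cΦ * f4 k + αΦ ^ 2 * f5 k) (P d) :=
    ((((hf1i.const_mul _).add (hf2i.const_mul _)).add (hf3i.const_mul _)).add (hf4i.const_mul _)).add
      (hf5i.const_mul _)
  -- the (3.64) expansion at `n = 1`, a.e. on the cube (off `{D̂ = 1}`)
  have hae : ∀ᵐ k ∂P d, (lapAtomsAt d cΦ αΦ cF αF RΦ RF k).H1 * (lapAtomsAt d cΦ αΦ cF αF RΦ RF k).G ^ 1 *
      Dhat d k ^ l * DhatSym d x k
      = (cΦ ^ 2 * αF * f1 k + 2 * (cΦ * αΦ) * αF * f2 k + αΦ ^ 2 * αF * f3 k + αΦ * cΦ * f4 k + αΦ ^ 2 * f5 k)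
        + R k := by
    filter_upwards [ae_mem_cube_and_Dhat_lt_one (d := d) (by omega)] with k hk
    have h := hKB k hk.1 hk.2
    have hG := (lapAtomsAt d cΦ αΦ cF αF RΦ RF k).G_eq_split h.Q_pos.ne' h.Cden_pos.ne'
    simp only [lapAtomsAt_cΦ, lapAtomsAt_αΦ, lapAtomsAt_D] at hG
    simp only [hf1, hf2, hf3, hf4, hf5, hR, LapAtoms.H1, lapAtomsAt_αF, lapAtomsAt_cΦ, lapAtomsAt_αΦ, lapAtomsAt_D]
    linear_combination ((αF * (cΦ + αΦ * Dhat d k) * (lapAtomsAt d cΦ αΦ cF αF RΦ RF k).Cstar + αΦ) *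
      (lapAtomsAt d cΦ αΦ cF αF RΦ RF k).Cstar * (lapAtomsAt d cΦ αΦ cF αF RΦ RF k).Mstar *
      (Dhat d k ^ l * DhatSym d x k)) * hG
  -- table nonnegativity and the five slot bounds
  have hIMnn : ∀ (m : ℕ) (j : ℕ), m ≤ 1 → 0 ≤ τ.IM m j x := fun m j hm =>
    nonneg_of_mul_nonneg_right ((srwI_nonneg (m + 3) (by omega) j x).trans (hSC m j x hm)) (mul_pos hd0 haf)
  have b1 : |αF * ((∫ k, f1 k ∂P d) / (2 * π) ^ d)| ≤ τ.IM 1 l x / r.afmin := by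
    have h := H1Slot.abs_alpha_mul_slot_le (dR := (d : ℝ)) 1 hd0 hα1 hαF hαFup (hIMnn 1 l le_rfl)
      (hIM 1 l x le_rfl) (srwIShift2_nonneg (p := 1 + 3) (by omega) l x) (hSC 1 l x le_rfl) (hLow 1 l x le_rfl)
      (hXup 1 l x le_rfl) (hXlo 1 l x le_rfl)
    simp only [pow_one, Nat.reduceAdd, Nat.cast_one] at h
    exact h
  have b2 : |αF * ((∫ k, f2 k ∂P d) / (2 * π) ^ d)| ≤ τ.IM 1 (l + 1) x / r.afmin := by
    have h := H1Slot.abs_alpha_mul_slot_le (dR := (d : ℝ)) 1 hd0 hα1 hαF hαFup (hIMnn 1 (l + 1) le_rfl)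
      (hIM 1 (l + 1) x le_rfl) (srwIShift2_nonneg (p := 1 + 3) (by omega) (l + 1) x) (hSC 1 (l + 1) x le_rfl)
      (hLow 1 (l + 1) x le_rfl) (hXup 1 (l + 1) x le_rfl) (hXlo 1 (l + 1) x le_rfl)
    simp only [pow_one, Nat.reduceAdd, Nat.cast_one] at h
    exact h
  have b3 : |αF * ((∫ k, f3 k ∂P d) / (2 * π) ^ d)| ≤ τ.IM 1 (l + 2) x / r.afmin := by
    have h := H1Slot.abs_alpha_mul_slot_le (dR := (d : ℝ)) 1 hd0 hα1 hαF hαFup (hIMnn 1 (l + 2) le_rfl)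
      (hIM 1 (l + 2) x le_rfl) (srwIShift2_nonneg (p := 1 + 3) (by omega) (l + 2) x) (hSC 1 (l + 2) x le_rfl)
      (hLow 1 (l + 2) x le_rfl) (hXup 1 (l + 2) x le_rfl) (hXlo 1 (l + 2) x le_rfl)
    simp only [pow_one, Nat.reduceAdd, Nat.cast_one] at h
    exact h
  have b4 : |(∫ k, f4 k ∂P d) / (2 * π) ^ d| ≤ τ.IM 0 l x / r.afmin := by
    have h := H1Slot.abs_slot_le (dR := (d : ℝ)) 0 hd0 hα1 hαF hαFup (hIMnn 0 l (by norm_num))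
      (hIM 0 l x (by norm_num)) (srwIShift2_nonneg (p := 0 + 3) (by omega) l x) (hSC 0 l x (by norm_num))
      (hLow 0 l x (by norm_num)) (hXup 0 l x (by norm_num)) (hXlo 0 l x (by norm_num))
    simp only [zero_add, pow_one, Nat.cast_zero] at h
    exact h
  have b5 : |(∫ k, f5 k ∂P d) / (2 * π) ^ d| ≤ τ.IM 0 (l + 1) x / r.afmin := by
    have h := H1Slot.abs_slot_le (dR := (d : ℝ)) 0 hd0 hα1 hαF hαFup (hIMnn 0 (l + 1) (by norm_num))
      (hIM 0 (l + 1) x (by norm_num)) (srwIShift2_nonneg (p := 0 + 3) (by omega) (l + 1) x)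
      (hSC 0 (l + 1) x (by norm_num)) (hLow 0 (l + 1) x (by norm_num)) (hXup 0 (l + 1) x (by norm_num))
      (hXlo 0 (l + 1) x (by norm_num))
    simp only [zero_add, pow_one, Nat.cast_zero] at h
    exact h
  -- the main part
  have hmainB : |cΦ ^ 2 * αF * ((∫ k, f1 k ∂P d) / (2 * π) ^ d) + 2 * (cΦ * αΦ) * αF * ((∫ k, f2 k ∂P d) / (2 * π) ^ d)
      + αΦ ^ 2 * αF * ((∫ k, f3 k ∂P d) / (2 * π) ^ d) + αΦ * cΦ * ((∫ k, f4 k ∂P d) / (2 * π) ^ d)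
      + αΦ ^ 2 * ((∫ k, f5 k ∂P d) / (2 * π) ^ d)|
      ≤ r.cp ^ 2 / r.afmin * τ.IM 1 l x + r.cp * r.ap / r.afmin * τ.IM 0 l x
        + 2 * (r.ap * r.cp / r.afmin) * τ.IM 1 (l + 1) x + r.ap ^ 2 / r.afmin * τ.IM 0 (l + 1) x
        + r.ap ^ 2 / r.afmin * τ.IM 1 (l + 2) x := by
    set Y1 := (∫ k, f1 k ∂P d) / (2 * π) ^ d
    set Y2 := (∫ k, f2 k ∂P d) / (2 * π) ^ d
    set Y3 := (∫ k, f3 k ∂P d) / (2 * π) ^ d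
    set Y4 := (∫ k, f4 k ∂P d) / (2 * π) ^ d
    set Y5 := (∫ k, f5 k ∂P d) / (2 * π) ^ d
    have e : cΦ ^ 2 * αF * Y1 + 2 * (cΦ * αΦ) * αF * Y2 + αΦ ^ 2 * αF * Y3 + αΦ * cΦ * Y4 + αΦ ^ 2 * Y5
        = cΦ ^ 2 * (αF * Y1) + 2 * (cΦ * αΦ) * (αF * Y2) + αΦ ^ 2 * (αF * Y3) + αΦ * cΦ * Y4 + αΦ ^ 2 * Y5 := by
      ring
    rw [e]
    have hcΦ2 : cΦ ^ 2 ≤ r.cp ^ 2 := pow_le_pow_left₀ hcΦ0 hcΦ 2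
    have hαΦ2 : |αΦ| ^ 2 ≤ r.ap ^ 2 := pow_le_pow_left₀ (abs_nonneg _) hαΦ 2
    have i1 : |cΦ ^ 2 * (αF * Y1)| ≤ r.cp ^ 2 * (τ.IM 1 l x / r.afmin) := by
      rw [abs_mul, abs_pow, abs_of_nonneg hcΦ0]
      exact mul_le_mul hcΦ2 b1 (abs_nonneg _) (pow_nonneg hcp 2)
    have i2 : |2 * (cΦ * αΦ) * (αF * Y2)| ≤ 2 * (r.cp * r.ap) * (τ.IM 1 (l + 1) x / r.afmin) := by
      rw [abs_mul]
      have h2 : |2 * (cΦ * αΦ)| ≤ 2 * (r.cp * r.ap) := by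
        rw [abs_mul, abs_mul, abs_two, abs_of_nonneg hcΦ0]
        exact mul_le_mul_of_nonneg_left (mul_le_mul hcΦ hαΦ (abs_nonneg _) hcp) two_pos.le
      exact mul_le_mul h2 b2 (abs_nonneg _) (by positivity)
    have i3 : |αΦ ^ 2 * (αF * Y3)| ≤ r.ap ^ 2 * (τ.IM 1 (l + 2) x / r.afmin) := by
      rw [abs_mul, abs_pow]
      exact mul_le_mul hαΦ2 b3 (abs_nonneg _) (pow_nonneg hap 2)
    have i4 : |αΦ * cΦ * Y4| ≤ r.ap * r.cp * (τ.IM 0 l x / r.afmin) := by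
      rw [abs_mul, abs_mul, abs_of_nonneg hcΦ0]
      exact mul_le_mul (mul_le_mul hαΦ hcΦ hcΦ0 hap) b4 (abs_nonneg _) (mul_nonneg hap hcp)
    have i5 : |αΦ ^ 2 * Y5| ≤ r.ap ^ 2 * (τ.IM 0 (l + 1) x / r.afmin) := by
      rw [abs_mul, abs_pow]
      exact mul_le_mul hαΦ2 b5 (abs_nonneg _) (pow_nonneg hap 2)
    have t2 : |cΦ ^ 2 * (αF * Y1) + 2 * (cΦ * αΦ) * (αF * Y2)|
        ≤ |cΦ ^ 2 * (αF * Y1)| + |2 * (cΦ * αΦ) * (αF * Y2)| := abs_add_le _ _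
    have t3 : |cΦ ^ 2 * (αF * Y1) + 2 * (cΦ * αΦ) * (αF * Y2) + αΦ ^ 2 * (αF * Y3)|
        ≤ |cΦ ^ 2 * (αF * Y1)| + |2 * (cΦ * αΦ) * (αF * Y2)| + |αΦ ^ 2 * (αF * Y3)| :=
      (abs_add_le _ _).trans (add_le_add t2 le_rfl)
    have t4 : |cΦ ^ 2 * (αF * Y1) + 2 * (cΦ * αΦ) * (αF * Y2) + αΦ ^ 2 * (αF * Y3) + αΦ * cΦ * Y4|
        ≤ |cΦ ^ 2 * (αF * Y1)| + |2 * (cΦ * αΦ) * (αF * Y2)| + |αΦ ^ 2 * (αF * Y3)| + |αΦ * cΦ * Y4| :=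
      (abs_add_le _ _).trans (add_le_add t3 le_rfl)
    calc |cΦ ^ 2 * (αF * Y1) + 2 * (cΦ * αΦ) * (αF * Y2) + αΦ ^ 2 * (αF * Y3) + αΦ * cΦ * Y4 + αΦ ^ 2 * Y5|
        ≤ |cΦ ^ 2 * (αF * Y1)| + |2 * (cΦ * αΦ) * (αF * Y2)| + |αΦ ^ 2 * (αF * Y3)| + |αΦ * cΦ * Y4|
          + |αΦ ^ 2 * Y5| := (abs_add_le _ _).trans (add_le_add t4 le_rfl)
      _ ≤ r.cp ^ 2 * (τ.IM 1 l x / r.afmin) + 2 * (r.cp * r.ap) * (τ.IM 1 (l + 1) x / r.afmin)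
          + r.ap ^ 2 * (τ.IM 1 (l + 2) x / r.afmin) + r.ap * r.cp * (τ.IM 0 l x / r.afmin)
          + r.ap ^ 2 * (τ.IM 0 (l + 1) x / r.afmin) :=
          add_le_add (add_le_add (add_le_add (add_le_add i1 i2) i3) i4) i5
      _ = _ := by ring
  -- the (3.65)-remainder part through the `T`-slots: pointwise, then integrated
  have hptR : ∀ k ∈ cube d, Dhat d k < 1 → |R k| ≤
      (r.bRp + r.bRfDelta * r.Gamma2dash) / r.afmin ^ 2 * r.cp *
          ((|Dhat d k| ^ l * |DhatSym d x k|) * (Chat d 1 k ^ 3 * (|Dhat d k| + 2 / r.afmin * (Dsin d k * Chat d 1 k))))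
        + (r.bRp + r.bRfDelta * r.Gamma2dash) / r.afmin ^ 2 * r.ap *
          ((|Dhat d k| ^ (l + 1) * |DhatSym d x k|) * (Chat d 1 k ^ 3 * (|Dhat d k| + 2 / r.afmin * (Dsin d k * Chat d 1 k))))
        + (r.bRp + r.bRfDelta * r.Gamma2dash) / r.afmin ^ 2 * r.ap *
          ((|Dhat d k| ^ l * |DhatSym d x k|) * (Chat d 1 k ^ 2 * (|Dhat d k| + 2 / r.afmin * (Dsin d k * Chat d 1 k)))) := by
    intro k hk hDk
    have h := hKB k hk hDk
    have hC : 1 / (1 - (lapAtomsAt d cΦ αΦ cF αF RΦ RF k).D) = Chat d 1 k := by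
      rw [lapAtomsAt_D, Chat, one_mul]
    have hb := h.abs_H1_mul_rem_le
    rw [hC, lapAtomsAt_D, lapAtomsAt_Dsin] at hb
    have hw : 0 ≤ |Dhat d k| ^ l * |DhatSym d x k| := by positivity
    simp only [hR]
    rw [abs_mul _ (Dhat d k ^ l * DhatSym d x k), abs_mul (Dhat d k ^ l), abs_pow]
    calc _ ≤ ((r.cp + r.ap * |Dhat d k|) * Chat d 1 k + r.ap) * (Chat d 1 k / r.afmin) *
            (|Dhat d k| + 2 * Dsin d k * (Chat d 1 k / r.afmin)) *
            ((r.bRp + r.bRfDelta * r.Gamma2dash) / r.afmin * Chat d 1 k) * (|Dhat d k| ^ l * |DhatSym d x k|) :=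
          mul_le_mul_of_nonneg_right hb hw
      _ = _ := by ring
  have hRB : |(∫ k, R k ∂P d) / (2 * π) ^ d| ≤ (r.bRp + r.bRfDelta * r.Gamma2dash) / r.afmin ^ 2 *
      (r.cp * τ.T 3 l x + r.ap * τ.T 3 (l + 1) x + r.ap * τ.T 2 l x) := by
    have hπ : (0 : ℝ) < (2 * π) ^ d := by positivity
    rw [abs_div, abs_of_pos hπ]
    refine (div_le_div_of_nonneg_right (abs_integral_le_integral_abs) hπ.le).trans ?_
    have h3 := integral_div_le_of_le_three_monomials (d := d) (by omega) (fun k => abs_nonneg (R k))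
      (integrable_srwTS_integrand (m := 3) (by omega) r.afmin l x)
      (integrable_srwTS_integrand (m := 3) (by omega) r.afmin (l + 1) x)
      (integrable_srwTS_integrand (m := 2) (by omega) r.afmin l x) hptR
    rw [integral_srwTS_integrand_eq (m := 3) (by omega) r.afmin l x,
      integral_srwTS_integrand_eq (m := 3) (by omega) r.afmin (l + 1) x,
      integral_srwTS_integrand_eq (m := 2) (by omega) r.afmin l x] at h3
    refine h3.trans ?_
    have hT1 : srwTS d r.afmin 3 l x ≤ τ.T 3 l x := hT 3 l x
    have hT2 : srwTS d r.afmin 3 (l + 1) x ≤ τ.T 3 (l + 1) x := hT 3 (l + 1) x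
    have hT3 : srwTS d r.afmin 2 l x ≤ τ.T 2 l x := hT 2 l x
    have hc1 : 0 ≤ (r.bRp + r.bRfDelta * r.Gamma2dash) / r.afmin ^ 2 * r.cp := by positivity
    have hc2 : 0 ≤ (r.bRp + r.bRfDelta * r.Gamma2dash) / r.afmin ^ 2 * r.ap := by positivity
    calc _ ≤ (r.bRp + r.bRfDelta * r.Gamma2dash) / r.afmin ^ 2 * r.cp * τ.T 3 l x
          + (r.bRp + r.bRfDelta * r.Gamma2dash) / r.afmin ^ 2 * r.ap * τ.T 3 (l + 1) x
          + (r.bRp + r.bRfDelta * r.Gamma2dash) / r.afmin ^ 2 * r.ap * τ.T 2 l x :=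
          add_le_add_three (mul_le_mul_of_nonneg_left hT1 hc1) (mul_le_mul_of_nonneg_left hT2 hc2)
            (mul_le_mul_of_nonneg_left hT3 hc2)
      _ = _ := by ring
  -- assemble
  have hbd : F3Bounds.boundH1 τ 1 l x r
      = (r.cp ^ 2 / r.afmin * τ.IM 1 l x + r.cp * r.ap / r.afmin * τ.IM 0 l x
          + 2 * (r.ap * r.cp / r.afmin) * τ.IM 1 (l + 1) x + r.ap ^ 2 / r.afmin * τ.IM 0 (l + 1) x
          + r.ap ^ 2 / r.afmin * τ.IM 1 (l + 2) x)
        + (r.bRp + r.bRfDelta * r.Gamma2dash) / r.afmin ^ 2 *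
          (r.cp * τ.T 3 l x + r.ap * τ.T 3 (l + 1) x + r.ap * τ.T 2 l x) := rfl
  by_cases hint : Integrable (fun k => (lapAtomsAt d cΦ αΦ cF αF RΦ RF k).H1 *
      (lapAtomsAt d cΦ αΦ cF αF RΦ RF k).G ^ 1 * Dhat d k ^ l * DhatSym d x k) (P d)
  · have hRi : Integrable R (P d) := by
      refine (hint.sub hmainI).congr ?_
      filter_upwards [hae] with k hk
      rw [Pi.sub_apply, hk]
      ring
    have hspl : (∫ k, (lapAtomsAt d cΦ αΦ cF αF RΦ RF k).H1 * (lapAtomsAt d cΦ αΦ cF αF RΦ RF k).G ^ 1 *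
          Dhat d k ^ l * DhatSym d x k ∂P d) / (2 * π) ^ d
        = (cΦ ^ 2 * αF * ((∫ k, f1 k ∂P d) / (2 * π) ^ d) + 2 * (cΦ * αΦ) * αF * ((∫ k, f2 k ∂P d) / (2 * π) ^ d)
            + αΦ ^ 2 * αF * ((∫ k, f3 k ∂P d) / (2 * π) ^ d) + αΦ * cΦ * ((∫ k, f4 k ∂P d) / (2 * π) ^ d)
            + αΦ ^ 2 * ((∫ k, f5 k ∂P d) / (2 * π) ^ d))
          + (∫ k, R k ∂P d) / (2 * π) ^ d := by
      rw [integral_congr_ae hae, integral_add hmainI hRi, add_div,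
        integral_div_five_terms _ _ _ _ _ hf1i hf2i hf3i hf4i hf5i]
    rw [hspl, hbd]
    exact (abs_add_le _ _).trans (add_le_add hmainB hRB)
  · rw [integral_undef hint, zero_div, abs_zero, hbd]
    exact add_nonneg ((abs_nonneg _).trans hmainB) ((abs_nonneg _).trans hRB)

end StepOne

end Literature.Probability.FitznerVanDerHofstad2017

end
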